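import Literature.Analysis.Asymptotics.PowerSumAbelian
import Summits.QuantumFields.BalabanUV.Beta.EriceFlowEnclosureWeightedTauberianSeq

/-!
# Beta / EriceFlowEnclosureWeightedTauberianPower — WHICH WEIGHTED CUTOFF AVERAGES KEEP THE ORDINARY TAUBERIAN CLASS: MASSES OF POSITIVE
# INDEX (`P N∕N^α → c > 0`, α > 0) SATISFY P2 #54c's GROWTH CONDITION (G); HENCE (C,1) (α = 1) AND EVERY POWER WEIGHT `p n = (n+1)^σ`,
# −1 < σ ≤ 0 (α = σ + 1): **`(Σ_{n<N} (n+1)^σ·a n)∕(Σ_{n<N} (n+1)^σ) → m ⟺ a n → m` for a slowly oscillating** (pure [folklore] SERVICE for the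
# BARE ∕ CUTOFF side of rows L131–L142; imports P2 #54c and the tree's `Literature.Analysis.Asymptotics.PowerSumAbelian`).
#   `growth_of_tendsto_div_rpow` — (G) with `ρ = (1 + q^α)∕2` from `P N∕N^α → c > 0`, α > 0 (eventually `P N ≤ (c + δ)N^α` and
#   `P J ≥ (c − δ)J^α ≥ (c − δ)q^α N^α` for J ≥ qN, with δ chosen so that `(c − δ)q^α = ρ(c + δ)`); `tendsto_atTop_of_tendsto_div_rpow` (such a
#   mass diverges); `growth_one` (p ≡ 1); `powerSum_tendsto_div_rpow` (`(Σ_{n<N}(n+1)^σ)∕N^{σ+1} → (σ+1)⁻¹`, the tree's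
#   `tendsto_sum_range_rpow_mul_rpow_neg` [BinghamGoldieTeugels1987, Prop. 1.5.8] rewritten); END **`powerMean_iff_tendsto_of_slowlyOscillating`**.
#   The boundary σ = −1 — the LOGARITHMIC means, mass `Σ 1∕(n+1) ∼ log N`, index 0 — violates (G) (`log(qN)∕log N → 1`) and there the
#   equivalence FAILS in the ordinary class: P2 #54e's witness `sin(log n)` is slowly oscillating, bounded, logarithmically summable to 0 and
#   divergent; the logarithmic Tauberian class is slow decrease on the POWER scales N → N^λ (Kwee 1967 ∕ Móricz 2013, in the tree).
# (β-flow team, prover 2 = lower ∕ positivity side, unit `b2b-balaban-beta-bflow-p2`, gen 37; module P2 #54d; no Erice sentence occurs)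

HONEST FRAMING (page 1 of everything the β sub-cell writes): discharging `BetaPertH` makes Bałaban's UV stability UNCONDITIONAL — a
real constructive-QFT result; it is NOT the continuum limit and NOT the Clay problem.  HONEST DEPENDENCY (cell reorg 2026-08-19,
verbatim): «continuum YM on T⁴ ⇐ BetaPertH ∧ nine spine estimates (0/9 proved); BetaPertH ⇐ (D1) ∧ (D4) ∧ CAP+tail; G-an2-4 gates
asym, D1 and NE2/3/4.»  THIS MODULE DISCHARGES NOTHING and quotes nothing: [folklore] real analysis about real sequences (regular variation of
the power sums: N. H. Bingham, C. M. Goldie, J. L. Teugels, Regular Variation (1987) Prop. 1.5.8 — in the tree; the Tauberian content is P2 #54c's).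

THE POINT.  (G) asks the mass to grow by a factor ρ(q) > 1 across every window [N, qN]; a mass `∼ cN^α` grows by `q^α > 1`, which is what α > 0
buys and α = 0 loses.  In RG language (P2 #54f): averaging the sampled datum over cutoffs n < N with ANY power weight — uniform RG time (σ = 0) down
to almost-logarithmic (σ ↓ −1) — cannot create a limit the samples do not have; the logarithmic weight can.

WHAT THIS FILE PROVES (0 sorry, 0 def): `growth_of_tendsto_div_rpow`, `tendsto_atTop_of_tendsto_div_rpow`, `growth_one`, `powerSum_tendsto_div_rpow`,
END **`powerMean_iff_tendsto_of_slowlyOscillating`**.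
NOT CLAIMED: σ > 0 (increasing weights satisfy (G) trivially; not needed); general regularly varying masses with a non-constant slowly varying
factor; anything about β-functions (P2 #54f); `BetaPertH`; continuum; Clay.
-/

namespace Summit.QuantumFields.BalabanUV.Beta.EriceFlowEnclosureWeightedTauberianPower

open Finset Filter Topology
open Summit.QuantumFields.BalabanUV.Beta.EriceFlowEnclosureWeightedTauberianSeq

noncomputable section

variable {a p : ℕ → ℝ}

/-! ## Regularly varying mass of positive index; the power weights -/

/-- **(G) FROM A POSITIVE INDEX**: if `P N∕N^α → c` with α > 0 and c > 0 then (G) holds, with `ρ = (1 + q^α)∕2` for the window ratio q. [folklore] -/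
theorem growth_of_tendsto_div_rpow {α c : ℝ} (hα : 0 < α) (hc : 0 < c)
    (h : Tendsto (fun N : ℕ => (∑ n ∈ range N, p n) / (N : ℝ) ^ α) atTop (𝓝 c)) :
    ∀ q > (1:ℝ), ∃ ρ > (1:ℝ), ∃ N₁ : ℕ, ∀ N J : ℕ, N₁ ≤ N → q * N ≤ (J : ℝ) →
      ρ * (∑ n ∈ range N, p n) ≤ ∑ n ∈ range J, p n := by
  intro q hq
  have hq0 : 0 < q := by linarith
  have hqα : 1 < q ^ α := Real.one_lt_rpow hq hα
  set ρ : ℝ := (1 + q ^ α) / 2 with hρ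
  have hρ1 : 1 < ρ := by rw [hρ]; linarith
  have hρq : ρ < q ^ α := by rw [hρ]; linarith
  set δ : ℝ := c * (q ^ α - ρ) / (q ^ α + ρ) with hδ
  have hden : 0 < q ^ α + ρ := by linarith
  have hδ0 : 0 < δ := by rw [hδ]; exact div_pos (mul_pos hc (by linarith)) hden
  have hcδ : 0 < c - δ := by
    rw [hδ, sub_pos, div_lt_iff₀ hden]; nlinarith
  have hkey : (c - δ) * q ^ α = ρ * (c + δ) := by
    rw [hδ]; field_simp; ring
  obtain ⟨N₁, hN₁⟩ := Metric.tendsto_atTop.mp h δ hδ0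
  refine ⟨ρ, hρ1, max N₁ 1, fun N J hN hJ => ?_⟩
  have hN1 : N₁ ≤ N := le_trans (le_max_left _ _) hN
  have hNpos : (1 : ℝ) ≤ N := by exact_mod_cast le_trans (le_max_right _ _) hN
  have hN0 : (0 : ℝ) < N := by linarith
  have hNJ : (N : ℝ) ≤ J := by nlinarith
  have hJ0 : (0 : ℝ) < J := by linarith
  have hJ1 : N₁ ≤ J := by exact_mod_cast (show (N₁ : ℝ) ≤ J from le_trans (Nat.cast_le.mpr hN1) hNJ)
  have hNα : 0 < (N : ℝ) ^ α := Real.rpow_pos_of_pos hN0 α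
  have hJα : 0 < (J : ℝ) ^ α := Real.rpow_pos_of_pos hJ0 α
  -- P N ≤ (c + δ) N^α and (c − δ) J^α ≤ P J
  have h1 : ∑ n ∈ range N, p n ≤ (c + δ) * (N : ℝ) ^ α := by
    have := hN₁ N hN1; rw [Real.dist_eq] at this
    have h' := (abs_lt.mp this).2
    rw [sub_lt_iff_lt_add, div_lt_iff₀ hNα] at h'; linarith
  have h2 : (c - δ) * (J : ℝ) ^ α ≤ ∑ n ∈ range J, p n := by
    have := hN₁ J hJ1; rw [Real.dist_eq] at this
    have h' := (abs_lt.mp this).1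
    rw [lt_sub_iff_add_lt, lt_div_iff₀ hJα] at h'; linarith
  -- J^α ≥ (qN)^α = q^α N^α
  have h3 : q ^ α * (N : ℝ) ^ α ≤ (J : ℝ) ^ α := by
    rw [← Real.mul_rpow hq0.le hN0.le]
    exact Real.rpow_le_rpow (by positivity) hJ hα.le
  calc ρ * ∑ n ∈ range N, p n ≤ ρ * ((c + δ) * (N : ℝ) ^ α) := mul_le_mul_of_nonneg_left h1 (by linarith)
    _ = (c - δ) * (q ^ α * (N : ℝ) ^ α) := by rw [← mul_assoc, ← hkey]; ring
    _ ≤ (c - δ) * (J : ℝ) ^ α := mul_le_mul_of_nonneg_left h3 hcδ.le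
    _ ≤ ∑ n ∈ range J, p n := h2

/-- A mass of positive index diverges: `P N∕N^α → c > 0`, α > 0 ⟹ `P N → ∞`. [folklore] -/
theorem tendsto_atTop_of_tendsto_div_rpow {α c : ℝ} (hα : 0 < α) (hc : 0 < c)
    (h : Tendsto (fun N : ℕ => (∑ n ∈ range N, p n) / (N : ℝ) ^ α) atTop (𝓝 c)) :
    Tendsto (fun N => ∑ n ∈ range N, p n) atTop atTop := by
  have hNα : Tendsto (fun N : ℕ => (N : ℝ) ^ α) atTop atTop :=
    (tendsto_rpow_atTop hα).comp tendsto_natCast_atTop_atTop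
  have := h.pos_mul_atTop hc hNα
  refine this.congr' ?_
  filter_upwards [eventually_gt_atTop 0] with N hN
  have hN0 : (0 : ℝ) < (N : ℝ) ^ α := Real.rpow_pos_of_pos (Nat.cast_pos.mpr hN) α
  rw [div_mul_cancel₀ _ hN0.ne']

/-- (G) FOR p ≡ 1 (the (C,1) mass `P N = N`, index 1). [folklore] -/
theorem growth_one :
    ∀ q > (1:ℝ), ∃ ρ > (1:ℝ), ∃ N₁ : ℕ, ∀ N J : ℕ, N₁ ≤ N → q * N ≤ (J : ℝ) →
      ρ * (∑ _n ∈ range N, (1 : ℝ)) ≤ ∑ _n ∈ range J, (1 : ℝ) := by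
  refine growth_of_tendsto_div_rpow (p := fun _ => (1 : ℝ)) one_pos one_pos ?_
  refine tendsto_const_nhds.congr' ?_
  filter_upwards [eventually_gt_atTop 0] with N hN
  have hN0 : (N : ℝ) ≠ 0 := Nat.cast_ne_zero.mpr (Nat.pos_iff_ne_zero.mp hN)
  rw [sum_const, card_range, nsmul_eq_mul, mul_one, Real.rpow_one, div_self hN0]

/-- THE POWER MASS HAS INDEX σ + 1: for −1 < σ ≤ 0, `(Σ_{n<N} (n+1)^σ)∕N^{σ+1} → (σ+1)⁻¹` (the tree's `tendsto_sum_range_rpow_mul_rpow_neg`,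
[BinghamGoldieTeugels1987, Prop. 1.5.8], rewritten from `· N^{−(σ+1)}` to `∕ N^{σ+1}`). [folklore] -/
theorem powerSum_tendsto_div_rpow {σ : ℝ} (hσ1 : -1 < σ) (hσ0 : σ ≤ 0) :
    Tendsto (fun N : ℕ => (∑ n ∈ range N, ((n : ℝ) + 1) ^ σ) / (N : ℝ) ^ (σ + 1)) atTop (𝓝 (σ + 1)⁻¹) := by
  refine (Literature.Analysis.Asymptotics.tendsto_sum_range_rpow_mul_rpow_neg hσ1 hσ0).congr' ?_
  filter_upwards [eventually_ge_atTop 0] with N _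
  rw [Real.rpow_neg (Nat.cast_nonneg N), div_eq_mul_inv]

/-- **THE POWER-WEIGHTED CUTOFF AVERAGES KEEP THE ORDINARY TAUBERIAN CLASS**: for −1 < σ ≤ 0 and a (SO) sequence,
**`(Σ_{n<N} (n+1)^σ·a n)∕(Σ_{n<N} (n+1)^σ) → m ⟺ a n → m`** — (G) with index α = σ + 1 > 0; σ = 0 is (C,1) (P2 #53a), σ ↓ −1 approaches the
logarithmic means, where (G) and the equivalence fail (P2 #54e). [folklore] -/
theorem powerMean_iff_tendsto_of_slowlyOscillating {σ : ℝ} (hσ1 : -1 < σ) (hσ0 : σ ≤ 0)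
    (hso : ∀ ε > 0, ∃ q > (1:ℝ), ∃ N₀ : ℕ, ∀ N i : ℕ, N₀ ≤ N → N ≤ i → (i : ℝ) ≤ q * N → |a i - a N| ≤ ε) (m : ℝ) :
    Tendsto (fun N => (∑ n ∈ range N, ((n : ℝ) + 1) ^ σ * a n) / ∑ n ∈ range N, ((n : ℝ) + 1) ^ σ) atTop (𝓝 m) ↔
      Tendsto a atTop (𝓝 m) := by
  have hp : ∀ n : ℕ, 0 ≤ ((n : ℝ) + 1) ^ σ := fun n => Real.rpow_nonneg (by positivity) σ
  have hα : 0 < σ + 1 := by linarith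
  have hc : 0 < (σ + 1)⁻¹ := inv_pos.mpr hα
  have hlim := powerSum_tendsto_div_rpow hσ1 hσ0
  exact weightedMean_iff_tendsto_of_slowlyOscillating hp (tendsto_atTop_of_tendsto_div_rpow hα hc hlim)
    (growth_of_tendsto_div_rpow hα hc hlim) hso m

end

end Summit.QuantumFields.BalabanUV.Beta.EriceFlowEnclosureWeightedTauberianPower
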